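import Mathlib
import Literature.Computability.AlgebraicComplexity.ArithCircuitProofs
import Literature.Computability.AlgebraicComplexity.IMMInVPProofs
import Literature.Computability.AlgebraicComplexity.HomogeneousComponentsComplexity
import HarnessLib

/-!
# Crux `BarrierLever.SuccinctHittingSetsForVP` (stmt-ValiantsHypothesis-14610), line `registered` —
ISOBARIC COMPONENTS: TORUS RESTRICTION AND CIRCUIT SIZE (toolkit for the registered stub
`stub_isobaricReduction`, wave 8)

**What is proved (general lemmas on weighted homogeneous components; they do NOT close the item).**
For a weight `w : ι → ℕ` on the variables of `MvPolynomial ι R` write `D_k` for the `w`-isobaric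
(weighted homogeneous) component `weightedHomogeneousComponent w k D`.

* `weightedHomogeneousComponent_aeval` : weighted components commute with weight-compatible
  substitutions (`isWeightedHomogeneous_aeval`, `sum_weightedHomogeneousComponent_range`).
* `eval_torus_eq_sum`, `eval_weightedHomogeneousComponent_eq_zero` : on the torus orbit
  `t ↦ (t^{w i} c_i)_i` a polynomial `D` restricts to the univariate `Σ_k t^k D_k(c)`; over `ℂ`, if
  `D` vanishes on the orbit then every `D_k(c) = 0`.
* `coeff_aeval_C_mul_X` : `coeff_m f(t x) = t^{|m|} coeff_m f` (the torus `x ↦ t x` on the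
  variables acts on the coefficient `c_m` with weight `|m|`), `totalDegree_aeval_C_mul_X_le`.
* `complexity_weightedHomogeneousComponent_le` (= registered sub-goal `stub_isobaricComponentSize`) :
  **SIZE OF AN ISOBARIC COMPONENT** for the weight
  `1 + w`: `L(Φ_j) ≤ (j+2)² (L(Φ) + Σ_i (w i + 1))`. Mechanism (one auxiliary variable `s`): the lift
  `c_i ↦ c_i s^{w i}` (`isWeightedHomogeneous_lift`) sends a monomial of degree `d` and `w`-weight `k`
  to a monomial of degree `d + k`, so the `(1 + w)`-components of `Φ` are the HOMOGENEOUS components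
  of the lift read back at `s = 1` (`aeval_back_aeval_lift`); the size bound is Bürgisser's
  substitution bound (`complexity_aeval_le`, Rem. 2.7) and Strassen's homogenisation
  (`complexity_homogeneousComponent_le_sq_mul`, BCS (21.25)). For a HOMOGENEOUS `Φ` of degree `d`
  the `w`-component of weight `k` is the `(1 + w)`-component of weight `d + k`
  (`weightedHomogeneousComponent_one_add`).

Axioms: `propext`, `Classical.choice`, `Quot.sound`. References: [Burgisser2000] Rem. 2.7;
[BurgisserClausenShokrollahi1997] (21.25); [ForbesShpilkaVolk2018] §1.2 (use). The
weighted-substitution lemmas are adapted from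
`Summits/…/BorderApolarityToricWitnessObstructionQPWeightedSubst.lean`.
-/

-- layout Summits/ValiantsHypothesis/ValiantsHypothesis forces the duplicated namespace component
set_option linter.dupNamespace false

namespace Summit.ValiantsHypothesis.ValiantsHypothesis.Theorems.BarrierLever.SuccinctHittingSetsForVP

open Literature.Computability.AlgebraicComplexity MvPolynomial

namespace Isobaric

variable {R : Type*} [CommSemiring R] {ι τ : Type*}

/-! ### Weighted components and weight-compatible substitutions -/

/-- **Weight-compatible substitutions preserve weighted homogeneity**: if each `g v` is
`w₂`-weighted homogeneous of weight `w₁ v`, then `aeval g` maps `w₁`-homogeneous polynomials of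
weight `j` to `w₂`-homogeneous polynomials of weight `j`. [folklore] -/
theorem isWeightedHomogeneous_aeval (w₁ : ι → ℕ) (w₂ : τ → ℕ)
    (g : ι → MvPolynomial τ R) (hg : ∀ v, IsWeightedHomogeneous w₂ (g v) (w₁ v))
    {Φ : MvPolynomial ι R} {j : ℕ} (hΦ : IsWeightedHomogeneous w₁ Φ j) :
    IsWeightedHomogeneous w₂ (aeval g Φ) j := by
  -- adapted from BorderApolarityToricWitnessObstructionQPWeightedSubst
  -- (`WeightedSubst.IsWeightedHomogeneous.aeval_of_forall`)
  classical
  rw [Φ.as_sum, map_sum]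
  refine IsWeightedHomogeneous.sum _ _ _ fun d hd => ?_
  have hwd : Finsupp.weight w₁ d = j := hΦ (mem_support_iff.1 hd)
  rw [aeval_monomial, ← hwd]
  have hprod : IsWeightedHomogeneous w₂ (d.prod fun v k => g v ^ k)
      (∑ v ∈ d.support, d v • w₁ v) := by
    unfold Finsupp.prod
    refine IsWeightedHomogeneous.prod _ _ _ fun v _ => ?_
    exact (hg v).pow (d v)
  have hw : (∑ v ∈ d.support, d v • w₁ v) = Finsupp.weight w₁ d := by
    rw [Finsupp.weight_apply, Finsupp.sum]
  rw [hw] at hprod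
  rw [← zero_add (Finsupp.weight w₁ d)]
  exact (isWeightedHomogeneous_C w₂ _).mul hprod

/-- A finite-sum decomposition into weighted components over any range containing the weights of
the support. [folklore] -/
theorem sum_weightedHomogeneousComponent_range (w : ι → ℕ) (Φ : MvPolynomial ι R) (K : ℕ)
    (hK : ∀ d ∈ Φ.support, Finsupp.weight w d ≤ K) :
    ∑ j ∈ Finset.range (K + 1), weightedHomogeneousComponent w j Φ = Φ := by
  -- adapted from BorderApolarityToricWitnessObstructionQPWeightedSubst
  classical
  have h := sum_weightedHomogeneousComponent w Φ
  rw [finsum_eq_sum_of_support_subset _ (s := Finset.range (K + 1))] at h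
  · exact h
  · intro j hj
    rw [Function.mem_support] at hj
    rw [Finset.coe_range, Set.mem_Iio, Nat.lt_succ_iff]
    by_contra hjK
    exact hj (weightedHomogeneousComponent_eq_zero' j Φ fun d hd => by
      have := hK d hd; omega)

/-- **Weighted components commute with weight-compatible substitutions.** [folklore] -/
theorem weightedHomogeneousComponent_aeval (w₁ : ι → ℕ) (w₂ : τ → ℕ)
    (g : ι → MvPolynomial τ R) (hg : ∀ v, IsWeightedHomogeneous w₂ (g v) (w₁ v))
    (Φ : MvPolynomial ι R) (j : ℕ) :
    weightedHomogeneousComponent w₂ j (aeval g Φ) =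
      aeval g (weightedHomogeneousComponent w₁ j Φ) := by
  -- adapted from BorderApolarityToricWitnessObstructionQPWeightedSubst
  classical
  set K : ℕ := (Φ.support.sup fun d => Finsupp.weight w₁ d) + j with hK
  have hle : ∀ d ∈ Φ.support, Finsupp.weight w₁ d ≤ K := fun d hd =>
    (Finset.le_sup (f := fun d => Finsupp.weight w₁ d) hd).trans (Nat.le_add_right _ _)
  conv_lhs => rw [← sum_weightedHomogeneousComponent_range w₁ Φ K hle, map_sum, map_sum]
  rw [Finset.sum_eq_single j]
  · exact (isWeightedHomogeneous_aeval w₁ w₂ g hg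
      (weightedHomogeneousComponent_isWeightedHomogeneous (w := w₁) j Φ)).weightedHomogeneousComponent_same
  · intro j' _ hj'
    exact (isWeightedHomogeneous_aeval w₁ w₂ g hg
      (weightedHomogeneousComponent_isWeightedHomogeneous (w := w₁) j' Φ)).weightedHomogeneousComponent_ne j
        (Ne.symm hj')
  · intro hj
    exfalso
    exact hj (Finset.mem_range.2 (by omega))

/-- For a HOMOGENEOUS polynomial of degree `d`, the `w`-isobaric component of weight `k` is the
`(1 + w)`-isobaric component of weight `d + k`. [folklore] -/
theorem weightedHomogeneousComponent_one_add {Φ : MvPolynomial ι R} {d : ℕ}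
    (hΦ : Φ.IsHomogeneous d) (w : ι → ℕ) (k : ℕ) :
    weightedHomogeneousComponent (fun i => 1 + w i) (d + k) Φ =
      weightedHomogeneousComponent w k Φ := by
  classical
  ext m
  simp only [coeff_weightedHomogeneousComponent]
  by_cases hm : coeff m Φ = 0
  · simp only [hm, ite_self]
  · have hdm : Finsupp.weight (1 : ι → ℕ) m = d := hΦ hm
    have hsplit : Finsupp.weight (fun i => 1 + w i) m =
        Finsupp.weight (1 : ι → ℕ) m + Finsupp.weight w m := by
      simp only [Finsupp.weight_apply, Finsupp.sum, Pi.one_apply, smul_eq_mul,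
        ← Finset.sum_add_distrib]
      exact Finset.sum_congr rfl fun i _ => by ring
    rw [hsplit, hdm]
    by_cases hk : Finsupp.weight w m = k
    · rw [if_pos hk, if_pos (by rw [hk])]
    · rw [if_neg hk, if_neg (by omega)]

/-- An isobaric component of a homogeneous polynomial of degree `d` is homogeneous of degree `d`
(its monomials are among those of the polynomial). [folklore] -/
theorem isHomogeneous_weightedHomogeneousComponent {Φ : MvPolynomial ι R} {d : ℕ}
    (hΦ : Φ.IsHomogeneous d) (w : ι → ℕ) (k : ℕ) :
    (weightedHomogeneousComponent w k Φ).IsHomogeneous d := by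
  classical
  intro m hm
  rw [coeff_weightedHomogeneousComponent] at hm
  split_ifs at hm with hw
  · exact hΦ hm
  · exact absurd rfl hm

/-! ### The torus `t ↦ (t^{w i} c_i)_i` and the isobaric components -/

/-- **Scaling an isobaric polynomial**: if `φ` is `w`-weighted homogeneous of weight `k`, then
`φ((t^{w i} c_i)_i) = t^k φ(c)`. [folklore] -/
theorem eval_torus_of_isWeightedHomogeneous (w : ι → ℕ) (c : ι → R) (t : R)
    {φ : MvPolynomial ι R} {k : ℕ} (hφ : IsWeightedHomogeneous w φ k) :
    eval (fun i => t ^ w i * c i) φ = t ^ k * eval c φ := by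
  classical
  conv_lhs => rw [φ.as_sum]
  conv_rhs => rw [φ.as_sum]
  rw [map_sum, map_sum, Finset.mul_sum]
  refine Finset.sum_congr rfl fun s hs => ?_
  have hks : Finsupp.weight w s = k := hφ (mem_support_iff.mp hs)
  rw [eval_monomial, eval_monomial, Finsupp.prod, Finsupp.prod]
  simp_rw [mul_pow, ← pow_mul]
  rw [Finset.prod_mul_distrib, Finset.prod_pow_eq_pow_sum]
  have hsum : ∑ i ∈ s.support, w i * s i = k := by
    rw [← hks, Finsupp.weight_apply, Finsupp.sum]
    exact Finset.sum_congr rfl fun i _ => by rw [smul_eq_mul, mul_comm]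
  rw [hsum]
  ring

/-- **The restriction of `D` to the torus orbit** `t ↦ (t^{w i} c_i)_i` is the univariate
polynomial `Σ_{k ≤ K} t^k D_k(c)`, `D_k` the `w`-isobaric components, `K` the weighted degree.
[folklore] -/
theorem eval_torus_eq_sum (w : ι → ℕ) (c : ι → R) (t : R) (D : MvPolynomial ι R) :
    eval (fun i => t ^ w i * c i) D =
      ∑ k ∈ Finset.range (weightedTotalDegree w D + 1),
        t ^ k * eval c (weightedHomogeneousComponent w k D) := by
  conv_lhs => rw [← sum_weightedHomogeneousComponent_range w D (weightedTotalDegree w D)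
    (fun d hd => le_weightedTotalDegree w hd)]
  rw [map_sum]
  exact Finset.sum_congr rfl fun k _ =>
    eval_torus_of_isWeightedHomogeneous w c t (weightedHomogeneousComponent_isWeightedHomogeneous k D)

/-- **Isobaric components of a polynomial vanishing on a torus orbit vanish**: if
`D((t^{w i} c_i)_i) = 0` for every `t ∈ ℂ`, then `D_k(c) = 0` for every `k` (a univariate
polynomial over `ℂ` with infinitely many roots is zero). [folklore] -/
theorem eval_weightedHomogeneousComponent_eq_zero {w : ι → ℕ} {c : ι → ℂ} {D : MvPolynomial ι ℂ}
    (h : ∀ t : ℂ, eval (fun i => t ^ w i * c i) D = 0) (k : ℕ) :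
    eval c (weightedHomogeneousComponent w k D) = 0 := by
  classical
  set K := weightedTotalDegree w D with hKdef
  -- the univariate restriction
  set P : Polynomial ℂ :=
    ∑ j ∈ Finset.range (K + 1),
      Polynomial.C (eval c (weightedHomogeneousComponent w j D)) * Polynomial.X ^ j with hP
  have hPeval : ∀ t, P.eval t = eval (fun i => t ^ w i * c i) D := by
    intro t
    rw [eval_torus_eq_sum, hP, Polynomial.eval_finsetSum]
    refine Finset.sum_congr rfl fun j _ => ?_
    rw [Polynomial.eval_mul, Polynomial.eval_C, Polynomial.eval_pow, Polynomial.eval_X, mul_comm]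
  have hP0 : P = 0 := by
    apply Polynomial.eq_zero_of_infinite_isRoot
    have huniv : {x | P.IsRoot x} = Set.univ := by
      ext t
      simp only [Set.mem_setOf_eq, Set.mem_univ, Polynomial.IsRoot, hPeval, h]
    rw [huniv]
    exact Set.infinite_univ
  by_cases hk : k ≤ K
  · have hcoeff : P.coeff k = eval c (weightedHomogeneousComponent w k D) := by
      rw [hP, Polynomial.finsetSum_coeff]
      simp only [Polynomial.coeff_C_mul, Polynomial.coeff_X_pow, mul_ite, mul_one, mul_zero]
      rw [Finset.sum_ite_eq (Finset.range (K + 1)) k, if_pos (Finset.mem_range.mpr (by omega))]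
    rw [← hcoeff, hP0, Polynomial.coeff_zero]
  · push Not at hk
    rw [weightedHomogeneousComponent_eq_zero k D hk, map_zero]

/-! ### The torus on the variables: `f(x) ↦ f(t x)` -/

/-- **Coefficients of `f(t x)`**: `coeff_m f(t x) = t^{|m|} coeff_m f`. [folklore] -/
theorem coeff_aeval_C_mul_X {σ : Type*} (t : R) (f : MvPolynomial σ R) (m : σ →₀ ℕ) :
    coeff m (aeval (fun i => (C t * X i : MvPolynomial σ R)) f) = t ^ m.degree * coeff m f := by
  classical
  induction f using MvPolynomial.induction_on' with
  | monomial s a =>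
    have h : aeval (fun i => (C t * X i : MvPolynomial σ R)) (monomial s a) =
        monomial s (t ^ s.degree * a) := by
      rw [aeval_monomial, algebraMap_eq, Finsupp.prod]
      simp only [mul_pow]
      rw [Finset.prod_mul_distrib, Finset.prod_pow_eq_pow_sum, ← C_pow, ← Finsupp.degree_apply,
        prod_X_pow_eq_monomial, C_mul_monomial, C_mul_monomial, mul_one, mul_comm]
    rw [h, coeff_monomial, coeff_monomial]
    split_ifs with hsm
    · subst hsm; rfl
    · rw [mul_zero]
  | add p q hp hq => rw [map_add, coeff_add, coeff_add, hp, hq, mul_add]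

/-- `f(t x)` has no more monomials than `f`, hence no larger degree. [folklore] -/
theorem totalDegree_aeval_C_mul_X_le {σ : Type*} (t : R) (f : MvPolynomial σ R) :
    (aeval (fun i => (C t * X i : MvPolynomial σ R)) f).totalDegree ≤ f.totalDegree := by
  refine totalDegree_le_of_support_subset fun m hm => ?_
  rw [mem_support_iff, coeff_aeval_C_mul_X] at hm
  exact mem_support_iff.mpr (right_ne_zero_of_mul hm)

/-- `L(x_i ^ e) ≤ e` (repeated multiplication, variables free). [cite: Burgisser2000, §2.1] -/
theorem complexity_X_pow_le (i : τ) (e : ℕ) :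
    complexity ((X i : MvPolynomial τ ℂ) ^ e) ≤ e := by
  -- adapted from `LowDegree.complexity_X_pow_le` (there for `Fin n` variables)
  induction e with
  | zero =>
    rw [pow_zero]
    simpa using (complexity_C_holds (σ := τ) (1 : ℂ)).le
  | succ e ih =>
    rw [pow_succ]
    calc complexity ((X i : MvPolynomial τ ℂ) ^ e * X i)
        ≤ complexity ((X i : MvPolynomial τ ℂ) ^ e) + complexity (X i : MvPolynomial τ ℂ) + 1 :=
          complexity_mul_le_holds _ _
      _ ≤ e + 0 + 1 := by rw [complexity_X_holds]; omega
      _ = e + 1 := by ring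

/-! ### The size of an isobaric component (one auxiliary variable) -/

/-- The lift `c_i ↦ c_i · s^{w i}` (`s` one auxiliary variable) is weight-compatible from the
weight `1 + w` to the degree. [folklore] -/
theorem isWeightedHomogeneous_lift (w : ι → ℕ) (i : ι) :
    IsWeightedHomogeneous (1 : Option ι → ℕ)
      (X (some i) * X none ^ w i : MvPolynomial (Option ι) R) (1 + w i) :=
  (isHomogeneous_X R (some i)).mul (isHomogeneous_X_pow (R := R) (none : Option ι) (w i))

/-- Reading the lift back at `s = 1` is the identity: `(c_i s^{w i})|_{s = 1} = c_i`. [folklore] -/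
theorem aeval_back_aeval_lift (w : ι → ℕ) (φ : MvPolynomial ι R) :
    aeval (fun o : Option ι => (o.elim 1 X : MvPolynomial ι R))
      (aeval (fun i => (X (some i) * X none ^ w i : MvPolynomial (Option ι) R)) φ) = φ := by
  induction φ using MvPolynomial.induction_on with
  | C a => rw [aeval_C, algebraMap_eq, aeval_C, algebraMap_eq]
  | add p q hp hq => rw [map_add, map_add, hp, hq]
  | mul_X p i hp =>
    rw [map_mul, map_mul, hp, aeval_X, map_mul, map_pow, aeval_X, aeval_X]
    simp

/-- **Size of an isobaric component** (weight `1 + w`, any polynomial): `L(Φ_j) ≤ (j+2)² ·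
(L(Φ) + Σ_i (w i + 1))` — lift with one auxiliary variable `s` (`c_i ↦ c_i s^{w i}`, Bürgisser's
substitution bound), take the HOMOGENEOUS component of degree `j` (Strassen's homogenisation,
BCS (21.25)), read back at `s = 1` (free). [cite: BurgisserClausenShokrollahi1997, Lemma (21.25)] -/
theorem complexity_weightedHomogeneousComponent_le [Fintype ι] (w : ι → ℕ)
    (Φ : MvPolynomial ι ℂ) (j : ℕ) :
    complexity (weightedHomogeneousComponent (fun i => 1 + w i) j Φ) ≤
      (j + 2) ^ 2 * (complexity Φ + ∑ i, (w i + 1)) := by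
  classical
  set g : ι → MvPolynomial (Option ι) ℂ := fun i => X (some i) * X none ^ w i with hg
  set back : Option ι → MvPolynomial ι ℂ := fun o => o.elim 1 X with hback
  have hgate : ∀ i, complexity (g i) ≤ w i + 1 := fun i =>
    calc complexity (g i)
        ≤ complexity (X (some i) : MvPolynomial (Option ι) ℂ) +
            complexity ((X none : MvPolynomial (Option ι) ℂ) ^ w i) + 1 := complexity_mul_le_holds _ _
      _ ≤ 0 + w i + 1 := by
          rw [complexity_X_holds]
          exact Nat.add_le_add_right (Nat.add_le_add_left (complexity_X_pow_le _ _) _) _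
      _ = w i + 1 := by ring
  have hlift : complexity (aeval g Φ) ≤ complexity Φ + ∑ i, (w i + 1) :=
    (complexity_aeval_le Φ g).trans (Nat.add_le_add_left (Finset.sum_le_sum fun i _ => hgate i) _)
  have hF : weightedHomogeneousComponent (fun i => 1 + w i) j Φ =
      aeval back (homogeneousComponent j (aeval g Φ)) := by
    rw [homogeneousComponent, weightedHomogeneousComponent_aeval (fun i => 1 + w i) 1 g
      (isWeightedHomogeneous_lift w) Φ j, aeval_back_aeval_lift]
  have hback0 : ∑ o, complexity (back o) = 0 := by
    refine Finset.sum_eq_zero fun o _ => ?_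
    cases o with
    | none => simpa [hback] using complexity_C_holds (σ := ι) (1 : ℂ)
    | some i => exact complexity_X_holds i
  rw [hF]
  calc complexity (aeval back (homogeneousComponent j (aeval g Φ)))
      ≤ complexity (homogeneousComponent j (aeval g Φ)) + ∑ o, complexity (back o) :=
        complexity_aeval_le _ _
    _ = complexity (homogeneousComponent j (aeval g Φ)) := by rw [hback0, add_zero]
    _ ≤ (j + 2) ^ 2 * complexity (aeval g Φ) := complexity_homogeneousComponent_le_sq_mul _ _
    _ ≤ (j + 2) ^ 2 * (complexity Φ + ∑ i, (w i + 1)) := Nat.mul_le_mul_left _ hlift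

end Isobaric

/-- **Registered sub-goal `stub_isobaricComponentSize`** (crux stmt-ValiantsHypothesis-14610, line
`registered`, wave 8; toolkit of `stub_isobaricReduction`): the size of an isobaric component for a
weight of the form `1 + w` — `L(Φ_j) ≤ (j+2)² (L(Φ) + Σ_i (w i + 1))`
(`Isobaric.complexity_weightedHomogeneousComponent_le`). [cite: BurgisserClausenShokrollahi1997, Lemma (21.25)] -/
theorem stub_isobaricComponentSize :
    ∀ (ι : Type) [Fintype ι] (w : ι → ℕ) (Φ : MvPolynomial ι ℂ) (j : ℕ),
      Literature.Computability.AlgebraicComplexity.complexity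
          (MvPolynomial.weightedHomogeneousComponent (fun i => 1 + w i) j Φ) ≤
        (j + 2) ^ 2 * (Literature.Computability.AlgebraicComplexity.complexity Φ + ∑ i, (w i + 1)) :=
  fun _ _ w Φ j => Isobaric.complexity_weightedHomogeneousComponent_le w Φ j

end Summit.ValiantsHypothesis.ValiantsHypothesis.Theorems.BarrierLever.SuccinctHittingSetsForVP
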